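import Mathlib
import Summits.ValiantsHypothesis.ValiantsHypothesis.Theorems.ValuativeGCTNoValuativeFlipSupportTransfer
import Literature.Computability.AlgebraicComplexity.OrbitClosureProofs
import Summits.ValiantsHypothesis.ValiantsHypothesis.Theorems.CutBites.Negative.LeftSLInvariantsDetPow

/-!
# Binary forms are determinantal: `Det_m` majorises every orbit closure on two letters

Crux `ValuativeGCT.ValuativeFlip` (stmt-ValiantsHypothesis-12624), wall-breaker axis 14
("plethysm tables, small cases certified"), in support of line `four-row-count`; first of two
files (the crux corollaries are in `ValuativeGCTValuativeFlipTwoRowNoFlip`).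

Every binary form of degree `m` over `ℂ` is a product of `m` linear forms
(`binForm_exists_eq_prod_linear`: dehomogenise, split over the algebraically closed field, re-
homogenise), hence a linear substitution of `det_m` — the determinant of a diagonal matrix of
linear forms (`prod_linear_eq_linSubst_detFormLex`).  So every substitution of ANY form `g` of
degree `m` by linear forms in two letters lies in `Δ(det_m)`
(`linSubst_mem_orbitClosure_detFormLex_of_card_le_two`), and by the landed support-transfer
principle (`NoValuativeFlip.orbitMultiplicity_le_of_weight_support`) the multiplicity in
`ℂ[Δ_m(g)]` of every weight of `GL_{m²}` supported on at most two letters is at most its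
multiplicity `K_m` in `ℂ[Δ(det_m)]` (`orbitMultiplicity_le_det_of_card_le_two`).  This is the
row-`≤ 2` entry of the few-row table: on two letters the determinant orbit closure is all of
`Sym^m ℂ²`, so no orbit closure can beat it there.

References: BLMW, SIAM J. Comput. 40 (2011) §5.3 (inheritance); J. M. Landsberg, *Geometry and
Complexity Theory* (2017) §6.8, §8.4; A. Beauville, Michigan Math. J. 48 (2000) (determinantal
hypersurfaces). Mathlib: `Polynomial.homogenize`, `IsAlgClosed.splits`,
`Polynomial.Splits.eq_prod_roots`, `AlgHom.map_det`, `Matrix.det_diagonal`; `det_m` as the determinant of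
the matrix of letters is the tree's `CutBites.Negative.detFormLex_eq_det_of`.
-/

set_option linter.dupNamespace false

noncomputable section

namespace Summit.ValiantsHypothesis.ValiantsHypothesis.Theorems.ValuativeFlip

open MvPolynomial
open scoped BigOperators Matrix
open Literature.NumberTheory.DiophantineGeometry Literature.Computability.AlgebraicComplexity


/-! ## Binary forms over `ℂ` are products of linear forms -/

section BinaryForms

/-- The dehomogenisation `q(X, 1)` of a binary form `q` of degree `n` has degree at most `n`.
[folklore] -/
theorem binForm_natDegree_aeval_le {q : MvPolynomial (Fin 2) ℂ} {n : ℕ} (hq : q.IsHomogeneous n) :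
    (MvPolynomial.aeval ![Polynomial.X, (1 : Polynomial ℂ)] q).natDegree ≤ n := by
  classical
  rw [q.as_sum, map_sum]
  refine Polynomial.natDegree_sum_le_of_forall_le _ _ fun s hs => ?_
  rw [MvPolynomial.aeval_monomial, ← Polynomial.C_eq_algebraMap]
  refine (Polynomial.natDegree_C_mul_le _ _).trans ?_
  rw [Finsupp.prod_fintype _ _ (by simp), Fin.prod_univ_two]
  simp only [Matrix.cons_val_zero, Matrix.cons_val_one, one_pow, mul_one]
  refine (Polynomial.natDegree_pow_le).trans ?_
  have h := hq (mem_support_iff.mp hs)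
  rw [Finsupp.weight_apply, Finsupp.sum_fintype _ _ (by simp), Fin.sum_univ_two] at h
  simp only [Pi.one_apply, smul_eq_mul, mul_one] at h
  calc s 0 * Polynomial.X.natDegree ≤ s 0 * 1 :=
        Nat.mul_le_mul_left _ Polynomial.natDegree_X_le
    _ ≤ n := by omega

/-- Products of products of linear binary forms are products of linear forms (`Fin.append`).
[folklore] -/
theorem binForm_prodLinear_mul {a b : ℕ} {p q : MvPolynomial (Fin 2) ℂ}
    (hp : ∃ u v : Fin a → ℂ, p = ∏ i, (C (u i) * X 0 + C (v i) * X 1))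
    (hq : ∃ u v : Fin b → ℂ, q = ∏ i, (C (u i) * X 0 + C (v i) * X 1)) :
    ∃ u v : Fin (a + b) → ℂ, p * q = ∏ i, (C (u i) * X 0 + C (v i) * X 1) := by
  obtain ⟨u, v, rfl⟩ := hp
  obtain ⟨u', v', rfl⟩ := hq
  refine ⟨Fin.append u u', Fin.append v v', ?_⟩
  rw [Fin.prod_univ_add]
  simp only [Fin.append_left, Fin.append_right]

/-- Transport of "product of `a` linear forms" along `a = b`. [folklore] -/
theorem binForm_prodLinear_congr {a b : ℕ} (h : a = b) {q : MvPolynomial (Fin 2) ℂ}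
    (hq : ∃ u v : Fin a → ℂ, q = ∏ i, (C (u i) * X 0 + C (v i) * X 1)) :
    ∃ u v : Fin b → ℂ, q = ∏ i, (C (u i) * X 0 + C (v i) * X 1) := by
  subst h
  exact hq

/-- A scalar multiple of a nonempty product of linear binary forms is one (rescale the first
factor). [folklore] -/
theorem binForm_prodLinear_smul {n : ℕ} (hn : 0 < n) {q : MvPolynomial (Fin 2) ℂ}
    (hq : ∃ u v : Fin n → ℂ, q = ∏ i, (C (u i) * X 0 + C (v i) * X 1)) (c : ℂ) :
    ∃ u v : Fin n → ℂ, C c * q = ∏ i, (C (u i) * X 0 + C (v i) * X 1) := by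
  obtain ⟨n', rfl⟩ : ∃ n', n = n' + 1 := ⟨n - 1, by omega⟩
  obtain ⟨u, v, rfl⟩ := hq
  refine ⟨Function.update u 0 (c * u 0), Function.update v 0 (c * v 0), ?_⟩
  rw [Fin.prod_univ_succ, Fin.prod_univ_succ]
  simp only [Function.update_self, ne_eq, Fin.succ_ne_zero, not_false_eq_true,
    Function.update_of_ne, map_mul]
  ring

/-- `X₁ ^ e` is a product of `e` linear binary forms. [folklore] -/
theorem binForm_prodLinear_X_pow (e : ℕ) :
    ∃ u v : Fin e → ℂ, ((X 1 : MvPolynomial (Fin 2) ℂ) ^ e) = ∏ i, (C (u i) * X 0 + C (v i) * X 1) :=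
  ⟨fun _ => 0, fun _ => 1, by simp⟩

/-- `∏ (X₀ - rᵢ X₁)` over a list of roots is a product of linear binary forms. [folklore] -/
theorem binForm_prodLinear_list (l : List ℂ) :
    ∃ u v : Fin l.length → ℂ, (l.map fun r => (X 0 - C r * X 1 : MvPolynomial (Fin 2) ℂ)).prod =
      ∏ i, (C (u i) * X 0 + C (v i) * X 1) := by
  induction l with
  | nil => exact ⟨fun _ => 0, fun _ => 0, by simp⟩
  | cons r l ih =>
    simp only [List.map_cons, List.prod_cons, List.length_cons]
    refine binForm_prodLinear_congr (Nat.add_comm _ _) (binForm_prodLinear_mul ?_ ih)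
    refine ⟨fun _ => 1, fun _ => -r, ?_⟩
    simp [sub_eq_add_neg]

/-- Degree of `∏ (X - rᵢ)` over a list is at most its length. [folklore] -/
theorem binForm_natDegree_list_prod_le (l : List ℂ) :
    (l.map fun r => Polynomial.X - Polynomial.C r).prod.natDegree ≤ l.length := by
  induction l with
  | nil => simp
  | cons r l ih =>
    simp only [List.map_cons, List.prod_cons, List.length_cons]
    refine (Polynomial.natDegree_mul_le).trans ?_
    have h1 : (Polynomial.X - Polynomial.C r).natDegree ≤ 1 :=
      (Polynomial.natDegree_sub_le _ _).trans (by simp)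
    omega

/-- Homogenising `∏ (X - rᵢ)` factor by factor gives `∏ (X₀ - rᵢ X₁)` (Mathlib
`Polynomial.homogenize_mul`). [folklore] -/
theorem binForm_homogenize_list_prod (l : List ℂ) :
    (l.map fun r => Polynomial.X - Polynomial.C r).prod.homogenize l.length =
      (l.map fun r => (X 0 - C r * X 1 : MvPolynomial (Fin 2) ℂ)).prod := by
  induction l with
  | nil => simp [Polynomial.homogenize_one]
  | cons r l ih =>
    simp only [List.map_cons, List.prod_cons, List.length_cons]
    have h1 : (Polynomial.X - Polynomial.C r).natDegree ≤ 1 :=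
      (Polynomial.natDegree_sub_le _ _).trans (by simp)
    rw [Nat.add_comm, Polynomial.homogenize_mul _ _ h1 (binForm_natDegree_list_prod_le l), ih,
      Polynomial.homogenize_sub, Polynomial.homogenize_X one_ne_zero, Polynomial.homogenize_C]
    simp

/-- **Binary forms over `ℂ` split into linear factors.** A homogeneous polynomial of degree
`n > 0` in two variables over `ℂ` is a product of `n` linear forms: dehomogenise, split the
univariate polynomial over the algebraically closed field `ℂ` (Mathlib `IsAlgClosed.splits`,
`Polynomial.Splits.eq_prod_roots`), and re-homogenise (`Polynomial.homogenize_eq_of_isHomogeneous`),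
the missing degree being made up by powers of `X₁`. [folklore: fundamental theorem of algebra for
binary forms] -/
theorem binForm_exists_eq_prod_linear {n : ℕ} (hn : 0 < n) (q : MvPolynomial (Fin 2) ℂ)
    (hq : q.IsHomogeneous n) :
    ∃ u v : Fin n → ℂ, q = ∏ i, (C (u i) * X 0 + C (v i) * X 1) := by
  classical
  by_cases hq0 : q = 0
  · refine ⟨0, 0, ?_⟩
    rw [hq0, eq_comm]
    exact Finset.prod_eq_zero (Finset.mem_univ (⟨0, hn⟩ : Fin n)) (by simp)
  set p : Polynomial ℂ := MvPolynomial.aeval ![Polynomial.X, (1 : Polynomial ℂ)] q with hp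
  have hhom : p.homogenize n = q := Polynomial.homogenize_eq_of_isHomogeneous hq rfl
  have hdeg : p.natDegree ≤ n := binForm_natDegree_aeval_le hq
  have hsplit : p.Splits := IsAlgClosed.splits p
  set d := p.natDegree with hd
  set lc := p.leadingCoeff with hlc
  have hcard : p.roots.card = d := hsplit.natDegree_eq_card_roots.symm
  set rl : List ℂ := p.roots.toList with hrl
  have hrl_len : rl.length = d := by rw [hrl, Multiset.length_toList, hcard]
  have hroots : (rl : Multiset ℂ) = p.roots := by rw [hrl, Multiset.coe_toList]
  have hprod : p = Polynomial.C lc * (rl.map fun r => Polynomial.X - Polynomial.C r).prod := by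
    conv_lhs => rw [hsplit.eq_prod_roots, ← hroots, Multiset.map_coe, Multiset.prod_coe]
  have hmul := Polynomial.homogenize_mul (Polynomial.C lc)
    (rl.map fun r => Polynomial.X - Polynomial.C r).prod (m := n - d) (n := d) (by simp)
    (hrl_len ▸ binForm_natDegree_list_prod_le rl)
  rw [Nat.sub_add_cancel hdeg, ← hprod, hhom, Polynomial.homogenize_C, ← hrl_len,
    binForm_homogenize_list_prod] at hmul
  have hmem : ∃ u v : Fin (n - rl.length + rl.length) → ℂ,
      ((X 1 : MvPolynomial (Fin 2) ℂ) ^ (n - rl.length) *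
        (rl.map fun r => (X 0 - C r * X 1 : MvPolynomial (Fin 2) ℂ)).prod) =
        ∏ i, (C (u i) * X 0 + C (v i) * X 1) :=
    binForm_prodLinear_mul (binForm_prodLinear_X_pow _) (binForm_prodLinear_list rl)
  have hfin := binForm_prodLinear_smul hn
    (binForm_prodLinear_congr (Nat.sub_add_cancel (hrl_len ▸ hdeg)) hmem) lc
  rw [hmul, mul_assoc]
  exact hfin

end BinaryForms

/-! ## Products of linear forms in two letters are substitutions of `det_m` -/

section DetSubst

variable {m : ℕ}

/-- `linSubst` of the two-letter diagonal substitution matrix on a variable: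
`X_{(i,j)} ↦ [i = j] (uᵢ X_a + vᵢ X_b)` for the matrix sending the letter `X_{(i,i)}` to
`uᵢ X_a + vᵢ X_b` and every off-diagonal letter to `0`. [folklore] -/
theorem linSubst_twoLetterDiag_X (a b : MatIdx m) (u v : Fin m → ℂ) (i j : Fin m) :
    linSubst (MatIdx m) ℂ (fun l p => if (ofLex p).1 = (ofLex p).2 then
        ((if l = a then u (ofLex p).1 else 0) + (if l = b then v (ofLex p).1 else 0)) else 0)
      (X (toLex (i, j))) =
      if i = j then u i • X a + v i • X b else 0 := by
  classical
  rw [linSubst_X]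
  by_cases hij : i = j
  · subst hij
    simp only [ofLex_toLex, if_true, add_smul, Finset.sum_add_distrib,
      ite_smul, zero_smul, Finset.sum_ite_eq', Finset.mem_univ]
  · simp [hij]

/-- **A product of `m` linear forms in two letters is a linear substitution of `det_m`**: it is the
determinant of the diagonal matrix of linear forms `diag(uᵢ X_a + vᵢ X_b)`, i.e. `A · det_m` for the
substitution `X_{(i,i)} ↦ uᵢ X_a + vᵢ X_b`, `X_{(i,j)} ↦ 0` (`i ≠ j`), whose rows other than `a`, `b`
vanish. [folklore] -/
theorem prod_linear_eq_linSubst_detFormLex (a b : MatIdx m) (u v : Fin m → ℂ) :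
    ∃ A : Matrix (MatIdx m) (MatIdx m) ℂ, (∀ l, l ≠ a → l ≠ b → ∀ p, A l p = 0) ∧
      (∏ i : Fin m, (u i • X a + v i • X b) : MvPolynomial (MatIdx m) ℂ) =
        linSubst (MatIdx m) ℂ A (detFormLex ℂ m) := by
  classical
  refine ⟨fun l p => if (ofLex p).1 = (ofLex p).2 then
      ((if l = a then u (ofLex p).1 else 0) + (if l = b then v (ofLex p).1 else 0)) else 0,
    fun l hla hlb p => by simp [hla, hlb], ?_⟩
  rw [CutBites.Negative.detFormLex_eq_det_of, AlgHom.map_det]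
  have hM : (AlgHom.mapMatrix (linSubst (MatIdx m) ℂ (fun l p => if (ofLex p).1 = (ofLex p).2 then
      ((if l = a then u (ofLex p).1 else 0) + (if l = b then v (ofLex p).1 else 0)) else 0)))
      (Matrix.of fun i j : Fin m => (X (toLex (i, j)) : MvPolynomial (MatIdx m) ℂ)) =
      Matrix.diagonal fun i => u i • X a + v i • X b := by
    ext i j
    rw [AlgHom.mapMatrix_apply, Matrix.map_apply, Matrix.of_apply, linSubst_twoLetterDiag_X,
      Matrix.diagonal_apply]
  rw [hM, Matrix.det_diagonal]

/-- Hence such a product lies in the endomorphism orbit of `det_m`, inside `Δ(det_m)`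
(`endOrbit_subset_orbitClosure_holds`). [folklore] -/
theorem prod_linear_mem_orbitClosure_detFormLex (a b : MatIdx m) (u v : Fin m → ℂ) :
    (∏ i : Fin m, (u i • X a + v i • X b) : MvPolynomial (MatIdx m) ℂ) ∈
      orbitClosure (detFormLex ℂ m) := by
  classical
  obtain ⟨A, -, hA⟩ := prod_linear_eq_linSubst_detFormLex a b u v
  rw [hA]
  exact endOrbit_subset_orbitClosure_holds _ ⟨_, rfl⟩

end DetSubst

/-! ## Every two-letter substitution of a form of degree `m` lies in `Δ(det_m)` -/

section TwoLetters

variable {m : ℕ}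

/-- **Forms of degree `m` in two letters are border-determinantal.** A homogeneous polynomial
`q` of degree `m ≥ 1` in the matrix variables `MatIdx m` involving only two letters `a`, `b`
lies in `Δ(det_m)`: pull `q` back to a binary form (`aeval`, the substitution is the identity on
the variables of `q`), split it into linear factors (`binForm_exists_eq_prod_linear`) and push the
factorisation forward (`prod_linear_mem_orbitClosure_detFormLex`). [folklore] -/
theorem mem_orbitClosure_detFormLex_of_vars_subset_pair [NeZero m] (a b : MatIdx m)
    {q : MvPolynomial (MatIdx m) ℂ} (hq : q.IsHomogeneous m) (hvars : ↑q.vars ⊆ ({a, b} : Set (MatIdx m))) :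
    q ∈ orbitClosure (detFormLex ℂ m) := by
  classical
  -- pull back to two variables
  let φ : MatIdx m → MvPolynomial (Fin 2) ℂ := fun l => if l = a then X 0 else if l = b then X 1 else 0
  let ψ : Fin 2 → MvPolynomial (MatIdx m) ℂ := ![X a, X b]
  set q₂ : MvPolynomial (Fin 2) ℂ := aeval φ q with hq₂
  have hφ : ∀ l, (φ l).IsHomogeneous 1 := by
    intro l
    simp only [φ]
    split_ifs
    · exact isHomogeneous_X ℂ 0
    · exact isHomogeneous_X ℂ 1
    · exact isHomogeneous_zero _ _ _
  have hq₂hom : q₂.IsHomogeneous m := by simpa only [one_mul] using hq.aeval φ hφ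
  have hback : aeval ψ q₂ = q := by
    rw [hq₂, ← AlgHom.comp_apply, comp_aeval]
    conv_rhs => rw [← aeval_X_left_apply (R := ℂ) q]
    refine (hom_congr_vars (by ext; simp) (fun l hl _ => ?_) rfl)
    have hl' : l = a ∨ l = b := by simpa using hvars (Finset.mem_coe.mpr hl)
    simp only [AlgHom.toRingHom_eq_coe, RingHom.coe_coe, aeval_X, φ, ψ]
    rcases hl' with rfl | rfl
    · simp
    · by_cases hba : l = a
      · subst hba; simp
      · simp [hba]
  obtain ⟨u, v, huv⟩ := binForm_exists_eq_prod_linear (NeZero.pos m) q₂ hq₂hom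
  have hq_eq : q = ∏ i : Fin m, (u i • X a + v i • X b) := by
    rw [← hback, huv, map_prod]
    refine Finset.prod_congr rfl fun i _ => ?_
    simp [ψ, smul_eq_C_mul]
  rw [hq_eq]
  exact prod_linear_mem_orbitClosure_detFormLex a b u v

/-- **Two-letter substitutions of a form of degree `m` lie in `Δ(det_m)`.** For `g` homogeneous
of degree `m ≥ 1`, a set `S` of at most two letters, and a matrix `A` whose rows outside `S`
vanish, `A · g ∈ Δ(det_m)` (the substituted form only involves the letters of `S`,
`vars_linSubst_subset`). [folklore] -/
theorem linSubst_mem_orbitClosure_detFormLex_of_card_le_two [NeZero m]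
    {g : MvPolynomial (MatIdx m) ℂ} (hg : g.IsHomogeneous m) (S : Finset (MatIdx m))
    (hS : S.card ≤ 2) (A : Matrix (MatIdx m) (MatIdx m) ℂ) (hA : ∀ i, i ∉ S → ∀ j, A i j = 0) :
    linSubst (MatIdx m) ℂ A g ∈ orbitClosure (detFormLex ℂ m) := by
  classical
  -- two letters `a`, `b` with `S ⊆ {a, b}`
  have a₀ : MatIdx m := toLex ((0 : Fin m), (0 : Fin m))
  obtain ⟨a, b, hab⟩ : ∃ a b : MatIdx m, (↑S : Set (MatIdx m)) ⊆ {a, b} := by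
    obtain ⟨l, hl⟩ : ∃ l : List (MatIdx m), l.toFinset = S ∧ l.length ≤ 2 := by
      refine ⟨S.toList, S.toList_toFinset, by rw [Finset.length_toList]; exact hS⟩
    obtain ⟨rfl, hlen⟩ := hl
    match l, hlen with
    | [], _ => exact ⟨a₀, a₀, by simp⟩
    | [a], _ => exact ⟨a, a, by simp⟩
    | [a, b], _ => exact ⟨a, b, by simp⟩
  have hvars : ↑(linSubst (MatIdx m) ℂ A g).vars ⊆ ({a, b} : Set (MatIdx m)) := by
    refine vars_linSubst_subset (A := Finset.univ) A (fun x l _ hx => hA x (fun hxS => hx (hab ?_)) l)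
      (by simp)
    exact Finset.mem_coe.mpr hxS
  exact mem_orbitClosure_detFormLex_of_vars_subset_pair a b (linSubst_isHomogeneous A hg) hvars

/-- **`Det_m` majorises every orbit closure on two letters.** For every form `g` of degree
`m ≥ 1` in the matrix variables and every weight `χ` of `GL_{m²}` supported on a set of at most two
letters, `mult_χ ℂ[Δ_m(g)] ≤ mult_χ ℂ[Δ(det_m)]` (support transfer,
`NoValuativeFlip.orbitMultiplicity_le_of_weight_support`, over
`linSubst_mem_orbitClosure_detFormLex_of_card_le_two`). BLMW 2011 §5.3. -/
theorem orbitMultiplicity_le_det_of_card_le_two {m : ℕ} [NeZero m] {g : MvPolynomial (MatIdx m) ℂ}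
    (hg : g.IsHomogeneous m) (S : Finset (MatIdx m)) (hS : S.card ≤ 2)
    (χ : Weight (MatIdx m)) (hχ : ∀ i, i ∉ S → χ i = 0) :
    orbitMultiplicity ℂ g m χ ≤ orbitMultiplicity ℂ (detFormLex ℂ m) m χ :=
  NoValuativeFlip.orbitMultiplicity_le_of_weight_support (detFormLex ℂ m) g (NeZero.ne m) S
    (fun A hA => linSubst_mem_orbitClosure_detFormLex_of_card_le_two hg S hS A hA) χ hχ

end TwoLetters

end Summit.ValiantsHypothesis.ValiantsHypothesis.Theorems.ValuativeFlip

end
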